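import Mathlib.NumberTheory.Divisors
import Mathlib.NumberTheory.Harmonic.Bounds
import Mathlib.Analysis.SpecialFunctions.Log.Basic
import HarnessLib

/-!
# Hallgren 2005 / class numbers under GRH — step N4a: `∑_{a ≤ A} τ(a)² ≤ A (1 + log A)³`

Topic `Literature/Computability/Cryptography`; proof companion of `HallgrenClassGroup.lean`
(named fact `Hallgren2005_classNumber_qsolvable_of_GRH`). Everything here is PROVED (theorems
only; no definition, no named fact).

The random-forms sampler of the class-number algorithm picks `a ≤ A ≍ √d` uniformly and a square
root `b` of `−d (mod 4a)`; a class whose reduced form has first coefficient `a` is hit with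
probability `≍ 1/(A · r(a))`, `r(a) ≤ τ(a)` the number of such roots, and the sampler must give up
on the `a` with `τ(a)` larger than a polylogarithmic threshold `K'`. The number of classes lost this
way is `≤ ∑_{a ≤ A, τ(a) > K'} τ(a) ≤ K'⁻¹ ∑_{a ≤ A} τ(a)²`, so the analysis needs the elementary
mean-square bound for the divisor function proved here:

* `sum_card_divisors_sq_le_card_quadruples` — `∑_{a ≤ A} τ(a)² ≤ #{(w, x, y, z) ∈ [1, A]⁴ : wxyz ≤ A}`
  (the pair of divisors `(u, v)` of `a` goes to `(gcd(u,v), u/gcd, v/gcd, a/lcm(u,v))`, injectively);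
* `card_quadruples_eq_sum_div` — `#{…} = ∑_{w, x, y ≤ A} ⌊A/(wxy)⌋`;
* `sum_card_divisors_sq_le` — **`∑_{a ≤ A} τ(a)² ≤ A (1 + log A)³`** (`∑_{n ≤ A} 1/n ≤ 1 + log A`,
  Mathlib `harmonic_le_one_add_log`).

(The true order is `A log³ A / π²`; Ramanujan 1916. Only the crude bound is needed.)

## References

* G. H. Hardy, E. M. Wright, *An Introduction to the Theory of Numbers*, Thm. 320 context
  (`∑ τ(n)² ∼ x log³x/π²`, Ramanujan) [folklore].
* A. M. Childs, W. van Dam, Rev. Mod. Phys. 82 (2010), §5.7 [ChildsVandam2010].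
-/

noncomputable section

open Finset

namespace Literature.Computability.Cryptography.Hallgren2005

/-- The quadruple attached to a number `a` and a pair `(u, v)` of its divisors:
`(gcd(u,v), u/gcd(u,v), v/gcd(u,v), a/lcm(u,v))`; as a plain function on `Σ a, ℕ × ℕ` (no new
definition is registered: it is a local `fun`). Its product is `a` and it determines `(a, u, v)`.
These two facts: [folklore] -/
theorem quadruple_prod_eq {a u v : ℕ} (hu : u ∣ a) (hv : v ∣ a) :
    Nat.gcd u v * (u / Nat.gcd u v) * (v / Nat.gcd u v) * (a / Nat.lcm u v) = a := by
  have h1 : Nat.gcd u v * (u / Nat.gcd u v) = u := Nat.mul_div_cancel' (Nat.gcd_dvd_left u v)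
  have h2 : u * (v / Nat.gcd u v) = Nat.lcm u v := by
    rw [Nat.lcm, Nat.mul_div_assoc u (Nat.gcd_dvd_right u v)]
  have h3 : Nat.lcm u v * (a / Nat.lcm u v) = a := Nat.mul_div_cancel' (Nat.lcm_dvd hu hv)
  rw [h1, h2, h3]

/-- **`∑_{a ≤ A} τ(a)² ≤ #{(w, x, y, z) ∈ [1, A]⁴ : wxyz ≤ A}`.** [folklore] -/
theorem sum_card_divisors_sq_le_card_quadruples (A : ℕ) :
    ∑ a ∈ Icc 1 A, a.divisors.card ^ 2 ≤
      ((((Icc 1 A) ×ˢ (Icc 1 A)) ×ˢ ((Icc 1 A) ×ˢ (Icc 1 A))).filter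
        (fun q : (ℕ × ℕ) × (ℕ × ℕ) => q.1.1 * q.1.2 * q.2.1 * q.2.2 ≤ A)).card := by
  classical
  -- the left side counts triples `(a, u, v)` with `u, v ∣ a`
  set S : Finset (Σ _ : ℕ, ℕ × ℕ) := (Icc 1 A).sigma fun a => a.divisors ×ˢ a.divisors with hS
  have hLHS : ∑ a ∈ Icc 1 A, a.divisors.card ^ 2 = S.card := by
    rw [hS, card_sigma]
    refine sum_congr rfl fun a _ => ?_
    rw [card_product, sq]
  rw [hLHS]
  -- the injection
  let Φ : (Σ _ : ℕ, ℕ × ℕ) → (ℕ × ℕ) × (ℕ × ℕ) := fun s =>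
    ((Nat.gcd s.2.1 s.2.2, s.2.1 / Nat.gcd s.2.1 s.2.2),
      (s.2.2 / Nat.gcd s.2.1 s.2.2, s.1 / Nat.lcm s.2.1 s.2.2))
  refine card_le_card_of_injOn Φ (fun s hs => ?_) (fun s hs s' hs' h => ?_)
  · -- maps into the quadruples
    obtain ⟨a, u, v⟩ := s
    simp only [hS, mem_coe, mem_sigma, mem_product] at hs
    obtain ⟨ha, hu, hv⟩ := hs
    rw [mem_Icc] at ha
    have ha0 : a ≠ 0 := by omega
    have hud : u ∣ a := Nat.dvd_of_mem_divisors hu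
    have hvd : v ∣ a := Nat.dvd_of_mem_divisors hv
    have hu0 : 0 < u := Nat.pos_of_mem_divisors hu
    have hv0 : 0 < v := Nat.pos_of_mem_divisors hv
    have hg0 : 0 < Nat.gcd u v := Nat.gcd_pos_of_pos_left v hu0
    have hprod := quadruple_prod_eq hud hvd
    set g := Nat.gcd u v with hg
    set x := u / g with hx
    set y := v / g with hy
    set z := a / Nat.lcm u v with hz
    have hx0 : 0 < x := Nat.div_pos (Nat.le_of_dvd hu0 (Nat.gcd_dvd_left u v)) hg0
    have hy0 : 0 < y := Nat.div_pos (Nat.le_of_dvd hv0 (Nat.gcd_dvd_right u v)) hg0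
    have hz0 : 0 < z := Nat.div_pos (Nat.le_of_dvd (by omega) (Nat.lcm_dvd hud hvd))
      (Nat.lcm_pos hu0 hv0)
    simp only [Φ, mem_coe, mem_filter, mem_product, mem_Icc]
    rw [← hg, ← hx, ← hy, ← hz]
    have hle : g * x * y * z ≤ A := by rw [hprod]; exact ha.2
    refine ⟨⟨⟨⟨hg0, ?_⟩, ⟨hx0, ?_⟩⟩, ⟨⟨hy0, ?_⟩, ⟨hz0, ?_⟩⟩⟩, hle⟩
    · calc g = g * 1 * 1 * 1 := by ring
        _ ≤ g * x * y * z := by gcongr <;> omega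
        _ ≤ A := hle
    · calc x = 1 * x * 1 * 1 := by ring
        _ ≤ g * x * y * z := by gcongr <;> omega
        _ ≤ A := hle
    · calc y = 1 * 1 * y * 1 := by ring
        _ ≤ g * x * y * z := by gcongr <;> omega
        _ ≤ A := hle
    · calc z = 1 * 1 * 1 * z := by ring
        _ ≤ g * x * y * z := by gcongr <;> omega
        _ ≤ A := hle
  · -- injective
    obtain ⟨a, u, v⟩ := s
    obtain ⟨a', u', v'⟩ := s'
    simp only [hS, mem_coe, mem_sigma, mem_product] at hs hs'
    obtain ⟨-, hu, hv⟩ := hs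
    obtain ⟨-, hu', hv'⟩ := hs'
    simp only [Φ, Prod.mk.injEq] at h
    obtain ⟨⟨hgg, hxx⟩, hyy, hzz⟩ := h
    have huu : u = u' := by
      have e1 := Nat.mul_div_cancel' (Nat.gcd_dvd_left u v)
      have e2 := Nat.mul_div_cancel' (Nat.gcd_dvd_left u' v')
      rw [← e1, ← e2, hxx, hgg]
    have hvv : v = v' := by
      have e1 := Nat.mul_div_cancel' (Nat.gcd_dvd_right u v)
      have e2 := Nat.mul_div_cancel' (Nat.gcd_dvd_right u' v')
      rw [← e1, ← e2, hyy, hgg]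
    subst huu hvv
    have haa : a = a' := by
      have e1 := Nat.mul_div_cancel' (Nat.lcm_dvd (Nat.dvd_of_mem_divisors hu) (Nat.dvd_of_mem_divisors hv))
      have e2 := Nat.mul_div_cancel' (Nat.lcm_dvd (Nat.dvd_of_mem_divisors hu') (Nat.dvd_of_mem_divisors hv'))
      rw [← e1, ← e2, hzz]
    subst haa
    rfl

/-- For `m ≥ 1`: `#{z ∈ [1, A] : m z ≤ A} = ⌊A/m⌋`. [folklore] -/
theorem card_filter_mul_le (A : ℕ) {m : ℕ} (hm : 0 < m) :
    ((Icc 1 A).filter (fun z => m * z ≤ A)).card = A / m := by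
  have hset : (Icc 1 A).filter (fun z => m * z ≤ A) = Icc 1 (A / m) := by
    ext z
    simp only [mem_filter, mem_Icc]
    constructor
    · rintro ⟨⟨h1, -⟩, h⟩
      exact ⟨h1, (Nat.le_div_iff_mul_le hm).mpr (by rwa [mul_comm] at h)⟩
    · rintro ⟨h1, h⟩
      have h' : z * m ≤ A := (Nat.le_div_iff_mul_le hm).mp h
      refine ⟨⟨h1, ?_⟩, by rwa [mul_comm] at h'⟩
      calc z = z * 1 := (mul_one z).symm
        _ ≤ z * m := Nat.mul_le_mul_left z hm
        _ ≤ A := h'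
  rw [hset, Nat.card_Icc, Nat.add_sub_cancel]

/-- **`#{(w, x, y, z) ∈ [1, A]⁴ : wxyz ≤ A} = ∑_{w, x, y ∈ [1, A]} ⌊A/(wxy)⌋`.** [folklore] -/
theorem card_quadruples_eq_sum_div (A : ℕ) :
    ((((Icc 1 A) ×ˢ (Icc 1 A)) ×ˢ ((Icc 1 A) ×ˢ (Icc 1 A))).filter
        (fun q : (ℕ × ℕ) × (ℕ × ℕ) => q.1.1 * q.1.2 * q.2.1 * q.2.2 ≤ A)).card =
      ∑ wx ∈ (Icc 1 A) ×ˢ (Icc 1 A), ∑ y ∈ Icc 1 A, A / (wx.1 * wx.2 * y) := by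
  classical
  rw [card_filter, sum_product (s := (Icc 1 A) ×ˢ (Icc 1 A)) (t := (Icc 1 A) ×ˢ (Icc 1 A))]
  refine sum_congr rfl fun wx hwx => ?_
  rw [sum_product (s := Icc 1 A) (t := Icc 1 A)]
  refine sum_congr rfl fun y hy => ?_
  rw [mem_product, mem_Icc, mem_Icc] at hwx
  rw [mem_Icc] at hy
  have hm : 0 < wx.1 * wx.2 * y := by
    have := Nat.mul_pos (Nat.mul_pos (by omega : 0 < wx.1) (by omega : 0 < wx.2)) (by omega : 0 < y)
    exact this
  rw [← card_filter_mul_le A hm, card_filter]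

/-- **`∑_{a ≤ A} τ(a)² ≤ A (1 + log A)³`** (for `A ≥ 1`; with the conventions `log 0 = 0` the bound
also holds trivially for `A = 0`). [folklore] -/
theorem sum_card_divisors_sq_le (A : ℕ) :
    ((∑ a ∈ Icc 1 A, a.divisors.card ^ 2 : ℕ) : ℝ) ≤ A * (1 + Real.log A) ^ 3 := by
  classical
  have h1 := sum_card_divisors_sq_le_card_quadruples A
  rw [card_quadruples_eq_sum_div] at h1
  have h1R : ((∑ a ∈ Icc 1 A, a.divisors.card ^ 2 : ℕ) : ℝ) ≤
      ((∑ wx ∈ (Icc 1 A) ×ˢ (Icc 1 A), ∑ y ∈ Icc 1 A, A / (wx.1 * wx.2 * y) : ℕ) : ℝ) := by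
    exact_mod_cast h1
  refine h1R.trans ?_
  -- harmonic sums
  set H : ℝ := ∑ i ∈ Icc 1 A, (1 : ℝ) / i with hH
  have hHle : H ≤ 1 + Real.log A := by
    rcases Nat.eq_zero_or_pos A with rfl | hA
    · simp [hH]
    · have h := harmonic_le_one_add_log A
      have hHq : H = (harmonic A : ℝ) := by
        rw [hH, harmonic_eq_sum_Icc]
        push_cast
        refine sum_congr rfl fun i _ => by simp
      rw [hHq]; exact h
  have hH0 : 0 ≤ H := sum_nonneg fun i _ => by positivity
  -- termwise: `⌊A/(wxy)⌋ ≤ A · (1/w)(1/x)(1/y)`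
  have hterm : ∀ wx ∈ (Icc 1 A) ×ˢ (Icc 1 A), ∀ y ∈ Icc 1 A,
      ((A / (wx.1 * wx.2 * y) : ℕ) : ℝ) ≤ A * ((1 : ℝ) / wx.1 * ((1 : ℝ) / wx.2) * ((1 : ℝ) / y)) := by
    intro wx hwx y hy
    rw [mem_product, mem_Icc, mem_Icc] at hwx
    rw [mem_Icc] at hy
    have hw : (0 : ℝ) < wx.1 := by exact_mod_cast (by omega : 0 < wx.1)
    have hx : (0 : ℝ) < wx.2 := by exact_mod_cast (by omega : 0 < wx.2)
    have hy' : (0 : ℝ) < y := by exact_mod_cast (by omega : 0 < y)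
    calc ((A / (wx.1 * wx.2 * y) : ℕ) : ℝ) ≤ (A : ℝ) / ((wx.1 * wx.2 * y : ℕ) : ℝ) := Nat.cast_div_le
      _ = A * ((1 : ℝ) / wx.1 * ((1 : ℝ) / wx.2) * ((1 : ℝ) / y)) := by
          push_cast
          field_simp
  calc ((∑ wx ∈ (Icc 1 A) ×ˢ (Icc 1 A), ∑ y ∈ Icc 1 A, A / (wx.1 * wx.2 * y) : ℕ) : ℝ)
      = ∑ wx ∈ (Icc 1 A) ×ˢ (Icc 1 A), ∑ y ∈ Icc 1 A, ((A / (wx.1 * wx.2 * y) : ℕ) : ℝ) := by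
        push_cast; rfl
    _ ≤ ∑ wx ∈ (Icc 1 A) ×ˢ (Icc 1 A), ∑ y ∈ Icc 1 A,
          (A : ℝ) * ((1 : ℝ) / wx.1 * ((1 : ℝ) / wx.2) * ((1 : ℝ) / y)) :=
        sum_le_sum fun wx hwx => sum_le_sum fun y hy => hterm wx hwx y hy
    _ = ∑ wx ∈ (Icc 1 A) ×ˢ (Icc 1 A), (A : ℝ) * ((1 : ℝ) / wx.1 * ((1 : ℝ) / wx.2)) * H := by
        refine sum_congr rfl fun wx _ => ?_
        rw [hH, mul_sum]
        refine sum_congr rfl fun y _ => by ring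
    _ = (A : ℝ) * (∑ wx ∈ (Icc 1 A) ×ˢ (Icc 1 A), (1 : ℝ) / wx.1 * ((1 : ℝ) / wx.2)) * H := by
        rw [← sum_mul, ← mul_sum]
    _ = (A : ℝ) * (H * H) * H := by
        congr 2
        rw [hH, sum_mul_sum, sum_product]
    _ = A * (H * H * H) := by ring
    _ ≤ A * (1 + Real.log A) ^ 3 := by
        have hA0 : (0 : ℝ) ≤ A := Nat.cast_nonneg A
        have : H * H * H ≤ (1 + Real.log A) ^ 3 := by
          rw [show (1 + Real.log A) ^ 3 = (1 + Real.log A) * (1 + Real.log A) * (1 + Real.log A) by ring]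
          have h0 : 0 ≤ 1 + Real.log A := hH0.trans hHle
          exact mul_le_mul (mul_le_mul hHle hHle hH0 h0) hHle hH0 (mul_nonneg h0 h0)
        exact mul_le_mul_of_nonneg_left this hA0

end Literature.Computability.Cryptography.Hallgren2005

end
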